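import Literature.NumberTheory.GaloisRepresentations.WeilDeligneRep
import HarnessLib

/-!
# Named fact: generic Weil–Deligne structures on a fixed `r` are conjugate (A'Campo–Hevesi–Thorne–Whitmore 2026, Prop. 6.0.5)

Topic `Literature/NumberTheory/GaloisRepresentations` (Weil–Deligne representations; companion of
`WeilDeligneRep.lean`, whose conventions `ρ(w) ∘ N = q^{deg w} • N ∘ ρ(w)` (`WeilDeligneRep.conj_N`)
are used verbatim). Grounder file (D-0014 named facts) for the routes
`Langlands/WeightVelocityMonodromy` and `Langlands/EisensteinMonodromy`, statement item
stmt-Langlands-2374 (`GenericWDUnique`: two Frobenius-semisimple GENERIC Weil–Deligne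
representations with the same traces are isomorphic).

In print (held, read 2026-08-15, `lit read arxiv:2607.11763` PDF pp. 112–113): L. A'Campo,
B. Hevesi, J. A. Thorne, D. Whitmore, *Local-global compatibility of automorphic Galois
representations over CM fields at p*, arXiv:2607.11763 (2026), §6:
* before Lemma 6.0.3 (p. 112): "Given a continuous semisimple representation `r : W_K → GL(V)` on
  a finite-dimensional `ℂ`-vector space, we define (following [Vog93]) `P(r) ≤ End(V)` to be the
  subspace of endomorphisms `N : V → V` such that `(r, N)` is a Weil–Deligne representation;
  equivalently, `P(r) = Hom_{W_K}(V, V(−1))`. Let `G(r) = Cent_{GL(V)}(r(W_K))`. Then `G(r)` is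
  a (connected) reductive group, and it acts on `P(r)`."
* Definition 6.0.4 (p. 113): "Let `(r, N)` be a Frobenius-semisimple Weil–Deligne
  representation on the finite-dimensional `ℂ`-vector space `V`. We say that `(r, N)` is
  generic if `Hom_WD((r, N), (r(1), N)) = 0`."
* Proposition 6.0.5 (p. 113): "Let `V` be a finite-dimensional `ℂ`-vector space, and let
  `r : W_K → GL(V)` be a continuous semisimple representation. Then: 1. `G(r)` has finitely
  many orbits in `P(r)`. In particular, there is a unique open orbit. 2. If `N ∈ P(r)`, then
  `N` lies in the unique open orbit if and only if `(r, N)` is a generic Weil–Deligne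
  representation. 3. Suppose that `N, N′ ∈ P(r)` and that `(r, N′)` is a generic Weil–Deligne
  representation. Then `(r, N) ≺ (r, N′)`." Proof: (1) is [Vog93, Prop. 4.5(4)] (D. Vogan,
  *The local Langlands conjecture*, 1993); (2): "the generic locus (as the locus where the map
  `ad_N : Hom_{W_K}(r, r(1)) → End_{W_K}(V)` is injective) is open in `P(r)`. It is also
  non-empty, and forms a single `G(r)`-orbit, by [A'C24, Lemma 3.1.9]."

WHAT IS VENDORED: the orbit-theoretic CONSEQUENCE of Prop. 6.0.5 (1)+(2) that needs no Zariski
topology to state — two generic monodromy operators `N, N′ ∈ P(r)` on the same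
Frobenius-semisimple `r` lie in the single generic `G(r)`-orbit, i.e. `N′ = g N g⁻¹` for some
`g ∈ GL(V)` centralising `r(W_K)`. Rendering of "generic" in the tree's convention (audited by
refuters g40-11 / g40-56 / g41-10 on item 2374, incl. an exhaustive orbit check in total
dimension ≤ 7): with `ρ(w) N = q^{deg w} N ρ(w)` the monodromy operator has Frobenius-weight
`+1`, and `Hom_WD((r,N),(r(1),N))` is the space of `f : V →ₗ V` of the OPPOSITE weight,
`f ∘ ρ(w) = q^{deg w} • ρ(w) ∘ f` for all `w`, commuting with `N`; generic := every such `f` is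
`0` (the locus where `ad_N` is injective on `Hom_{W_K}(r, r(1))`, as in the printed proof).
"Frobenius-semisimple" = the tree's `WeilDeligneRep.IsFrobSemisimple` (every `ρ(w)` semisimple),
which for a representation trivial on an open subgroup of inertia makes `r` semisimple, the
printed standing hypothesis. Printed over `ℂ`; stated over `ℂ`.

Nothing is asserted; users take `(h : AHTW2026_prop_6_0_5_generic_conj)`. Item 2374
`GenericWDUnique` = Brauer–Nesbitt for `W_K` (equal traces + Frobenius-semisimplicity ⇒
`r ≅ r′`, transport `N′` to `V`) ∘ this fact, at `C = ℂ`; the item quantifies over an arbitrary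
algebraically closed field of characteristic `0` (STRONGER than print in that respect).

## References

* [AHTW2026] L. A'Campo, B. Hevesi, J. A. Thorne, D. Whitmore, arXiv:2607.11763, §6,
  Def. 6.0.4 and Prop. 6.0.5 (PDF pp. 112–113).
* [Vogan1993] D. A. Vogan, *The local Langlands conjecture*, Contemp. Math. 145 (1993),
  Prop. 4.5(4) (finitely many orbits) — cited through AHTW2026.
* [ACampo2024] L. A'Campo, *Rigidity of automorphic Galois representations over CM fields*,
  IMRN 2024, Lemma 3.1.9 (generic locus is one orbit) — cited through AHTW2026.
-/

namespace Literature.NumberTheory.GaloisRepresentations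

namespace WeilDeligneRep

open GaloisRepresentations.IsNonarchimedeanLocalField WeilGroup

/-- NAMED FACT (**A'Campo–Hevesi–Thorne–Whitmore 2026, Prop. 6.0.5 (1)–(2)**, with Def. 6.0.4;
after Vogan 1993 Prop. 4.5(4) and A'Campo 2024 Lemma 3.1.9). Let `K` be a non-archimedean local
field, `V` a finite-dimensional `ℂ`-vector space and `W, W′` two Weil–Deligne representations
on `V` with the SAME Weil-group action `r = W.ρ = W′.ρ`, Frobenius-semisimple. If both are
generic — no non-zero `f : V →ₗ V` with `f ∘ r(w) = q^{deg w} • r(w) ∘ f` for all `w` commutes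
with the monodromy operator (`Hom_WD((r,N),(r(1),N)) = 0`, Def. 6.0.4 in the convention of
`WeilDeligneRep.conj_N`) — then `W.N` and `W′.N` lie in the same `G(r)`-orbit: there is
`g ∈ GL(V)` commuting with every `r(w)` with `g ∘ W.N = W′.N ∘ g` ("there is a unique open orbit
… `N` lies in the unique open orbit if and only if `(r, N)` is generic"). Grounds
`Summit.Langlands.Langlands.Theses.WeightVelocityMonodromy.GenericWDUnique` /
`…EisensteinMonodromy.GenericWDUnique` (item stmt-Langlands-2374 = Brauer–Nesbitt transport ∘
this fact at `C = ℂ`). Users take `(h : AHTW2026_prop_6_0_5_generic_conj)`.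
[cite: AHTW2026, Prop. 6.0.5 (1)–(2) and Def. 6.0.4, PDF pp. 112–113] -/
def AHTW2026_prop_6_0_5_generic_conj : Prop :=
  ∀ {K : Type} [Field K] [ValuativeRel K] [TopologicalSpace K] [IsNonarchimedeanLocalField K]
    {V : Type} [AddCommGroup V] [Module ℂ V] [FiniteDimensional ℂ V]
    (W W' : WeilDeligneRep K ℂ V),
    W'.ρ = W.ρ → W.IsFrobSemisimple →
    (∀ f : V →ₗ[ℂ] V,
      (∀ w : WeilGroup K, f ∘ₗ W.ρ w = ((residueFieldCard K : ℂ) ^ (deg w)) • (W.ρ w ∘ₗ f)) →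
      f ∘ₗ W.N = W.N ∘ₗ f → f = 0) →
    (∀ f : V →ₗ[ℂ] V,
      (∀ w : WeilGroup K, f ∘ₗ W'.ρ w = ((residueFieldCard K : ℂ) ^ (deg w)) • (W'.ρ w ∘ₗ f)) →
      f ∘ₗ W'.N = W'.N ∘ₗ f → f = 0) →
    ∃ g : V ≃ₗ[ℂ] V, (∀ w : WeilGroup K, (g : V →ₗ[ℂ] V) ∘ₗ W.ρ w = W.ρ w ∘ₗ (g : V →ₗ[ℂ] V)) ∧
      (g : V →ₗ[ℂ] V) ∘ₗ W.N = W'.N ∘ₗ (g : V →ₗ[ℂ] V)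

/-- Consequence of `AHTW2026_prop_6_0_5_generic_conj`: under its hypotheses the two
Weil–Deligne representations are isomorphic (`WeilDeligneRep.IsEquivalent`), the conjugating
`g ∈ G(r)` being an isomorphism `(V, r, N) ≅ (V, r, N′)`.
[cite: AHTW2026, Prop. 6.0.5 (1)–(2)] -/
theorem AHTW2026_prop_6_0_5_generic_conj.isEquivalent (h : AHTW2026_prop_6_0_5_generic_conj)
    {K : Type} [Field K] [ValuativeRel K] [TopologicalSpace K] [IsNonarchimedeanLocalField K]
    {V : Type} [AddCommGroup V] [Module ℂ V] [FiniteDimensional ℂ V]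
    (W W' : WeilDeligneRep K ℂ V) (hρ : W'.ρ = W.ρ) (hss : W.IsFrobSemisimple)
    (hW : ∀ f : V →ₗ[ℂ] V,
      (∀ w : WeilGroup K, f ∘ₗ W.ρ w = ((residueFieldCard K : ℂ) ^ (deg w)) • (W.ρ w ∘ₗ f)) →
      f ∘ₗ W.N = W.N ∘ₗ f → f = 0)
    (hW' : ∀ f : V →ₗ[ℂ] V,
      (∀ w : WeilGroup K, f ∘ₗ W'.ρ w = ((residueFieldCard K : ℂ) ^ (deg w)) • (W'.ρ w ∘ₗ f)) →
      f ∘ₗ W'.N = W'.N ∘ₗ f → f = 0) :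
    W.IsEquivalent W' := by
  obtain ⟨g, hg, hgN⟩ := h W W' hρ hss hW hW'
  refine ⟨{ toRepEquiv := Representation.Equiv.mk g (fun w => ?_), comm_N := ?_ }⟩
  · rw [hρ]; exact hg w
  · exact hgN

end WeilDeligneRep

end Literature.NumberTheory.GaloisRepresentations
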